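import Summits.QuantumFields.YangMills.Theorems.SwapVirialDeficitZeroModeExactRealPartCDF
import HarnessLib

/-!
# Zero-mode EXACT rung Z2-c: the LAW of `re(q u)` under Haar measure on `SU(2)` is the semicircle density `(2/π)√(1−s²)` on `[−1,1]`
# (free-hands support of crux ⟨stmt-QuantumFields-24197⟩ `SwapVirialDeficit.SwapGluedStiffness`; item Z2 of fcl-p3 g43's zero-mode exact rung plan —
# the integral form, so that every `E_Haar[g(re q u)]` becomes a one-dimensional integral)

From the distribution function ✓`haar_re_le_eq` (`Haar{re ≤ x} = 1 − (arccos x − x√(1−x²))/π`, file Z2-b) and the antiderivative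
`d/ds[1 − (arccos s − s√(1−s²))/π] = (2/π)√(1−s²)` on `(−1,1)` (two finite measures on `ℝ` with equal distribution functions, ✓`Measure.ext_of_Iic`):
★★★ `map_re_eq_semicircle`: `Haar.map (re ∘ q) = vol|[−1,1].withDensity ((2/π)√(1−s²))`, and
★★★ `lintegral_haar_comp_re`: `∫ g(re q u) dHaar(u) = ∫_{[−1,1]} g(s)·(2/π)√(1−s²) ds` for every measurable `g ≥ 0` — the Sato–Tate / semicircle law
of `½ tr u` as a transfer formula (e.g. `E[(1−re²)⁻¹] = 2` of ✓`integral_haar_inv_one_sub_re_sq` is `(2/π)∫(1−s²)^{−1/2} = 2`).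

HONEST LABEL: exact finite-dimensional Haar identities (plan-level zero-mode rung of a DRAFT line); NOT the fixed-`L` sharp law, NOT ⟨24197⟩; no rung /
summit statement is proved; the Yang–Mills mass gap is NOT proved; no summit is proved by a line.  Width seat ym-line-sfw-p2-w3 g62 (cell ym-idea-1,
free hands; own crux ⟨22884⟩ blocked-on ⟨19935⟩), `--supports stmt-QuantumFields-24197`.  THEOREMS ONLY, standard axioms, 0 `sorry`.
References: [cite: Chatterjee2026YMHiggs, Lemma 5.1 / Cor. 5.2]; [folklore] (Sato–Tate / semicircle law on `SU(2)`).
-/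

set_option autoImplicit false

noncomputable section

open MeasureTheory Quaternion Set Real Filter
open scoped Quaternion ENNReal BigOperators Topology
open Literature.MathematicalPhysics.QuantumLattice
open Literature.MathematicalPhysics.QuantumFieldTheory (haarProbability)
open Literature.MathematicalPhysics.QuantumFieldTheory.Balaban1983to89.T4HaarSU2Translate (su2Quat_quatToSU2 measurable_su2Quat
  continuous_su2Quat)
open Summit.QuantumFields.YangMills.Theorems.SwapTwistDeficit.ToronLog

attribute [local instance] Literature.Analysis.FluidPDE.Tao2016.quatMeasurableSpace
  Literature.Analysis.FluidPDE.Tao2016.quatBorelSpace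
  Literature.MathematicalPhysics.QuantumLattice.secondCountableTopology_su2

namespace Summit.QuantumFields.YangMills.Theorems.SwapVirialDeficit.ZeroModeExact

/-! ## §28 The antiderivative of the semicircle density -/

/-- On `(−1,1)`: `d/ds [1 − (arccos s − s√(1−s²))/π] = (2/π)·√(1−s²)`. [folklore] -/
theorem hasDerivAt_semicircleCDF {s : ℝ} (h1 : -1 < s) (h2 : s < 1) :
    HasDerivAt (fun y : ℝ => 1 - (Real.arccos y - y * Real.sqrt (1 - y ^ 2)) / Real.pi) (2 / Real.pi * Real.sqrt (1 - s ^ 2)) s := by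
  have hpos : 0 < 1 - s ^ 2 := by nlinarith
  have hsq : 0 < Real.sqrt (1 - s ^ 2) := Real.sqrt_pos.2 hpos
  have hf : HasDerivAt (fun y : ℝ => 1 - y ^ 2) (-(2 * s)) s := by
    simpa using (hasDerivAt_pow 2 s).const_sub 1
  have hsqrt : HasDerivAt (fun y : ℝ => Real.sqrt (1 - y ^ 2)) (-(2 * s) / (2 * Real.sqrt (1 - s ^ 2))) s := hf.sqrt hpos.ne'
  have hprod : HasDerivAt (fun y : ℝ => y * Real.sqrt (1 - y ^ 2))
      (1 * Real.sqrt (1 - s ^ 2) + s * (-(2 * s) / (2 * Real.sqrt (1 - s ^ 2)))) s := (hasDerivAt_id s).mul hsqrt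
  have harc : HasDerivAt Real.arccos (-(1 / Real.sqrt (1 - s ^ 2))) s := Real.hasDerivAt_arccos (by linarith) (by linarith)
  have h := ((harc.sub hprod).div_const Real.pi).const_sub 1
  refine h.congr_deriv ?_
  have hss : Real.sqrt (1 - s ^ 2) * Real.sqrt (1 - s ^ 2) = 1 - s ^ 2 := Real.mul_self_sqrt hpos.le
  field_simp
  nlinarith [hss]

/-- The distribution function `F(x) = 1 − (arccos x − x√(1−x²))/π` is continuous. [folklore] -/
theorem continuous_semicircleCDF : Continuous fun y : ℝ => 1 - (Real.arccos y - y * Real.sqrt (1 - y ^ 2)) / Real.pi := by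
  have : Continuous fun y : ℝ => Real.sqrt (1 - y ^ 2) := Real.continuous_sqrt.comp (by fun_prop)
  exact continuous_const.sub ((Real.continuous_arccos.sub (continuous_id.mul this)).div_const _)

/-- ★ `∫_{−1}^{y} (2/π)√(1−s²) ds = 1 − (arccos y − y√(1−y²))/π` for `−1 ≤ y ≤ 1`. [folklore] -/
theorem integral_semicircle_density {y : ℝ} (hy1 : -1 ≤ y) (hy2 : y ≤ 1) :
    ∫ s in (-1 : ℝ)..y, 2 / Real.pi * Real.sqrt (1 - s ^ 2) = 1 - (Real.arccos y - y * Real.sqrt (1 - y ^ 2)) / Real.pi := by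
  have hcont : Continuous fun s : ℝ => 2 / Real.pi * Real.sqrt (1 - s ^ 2) :=
    continuous_const.mul (Real.continuous_sqrt.comp (by fun_prop))
  rw [intervalIntegral.integral_eq_sub_of_hasDerivAt_of_le hy1 continuous_semicircleCDF.continuousOn
    (fun s hs => hasDerivAt_semicircleCDF hs.1 (hs.2.trans_le hy2)) (hcont.intervalIntegrable _ _)]
  simp [Real.arccos_neg_one]

/-! ## §29 ★★★ The law of the real part -/

/-- Distribution function of the semicircle measure: `ν(Iic x) = 1 − (arccos x − x√(1−x²))/π` (all real `x`). [folklore] -/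
theorem semicircle_Iic (x : ℝ) :
    ((volume : Measure ℝ).restrict (Icc (-1) 1)).withDensity (fun s => ENNReal.ofReal (2 / Real.pi * Real.sqrt (1 - s ^ 2))) (Iic x) =
      ENNReal.ofReal (1 - (Real.arccos x - x * Real.sqrt (1 - x ^ 2)) / Real.pi) := by
  rw [withDensity_apply _ measurableSet_Iic, Measure.restrict_restrict measurableSet_Iic]
  have hcont : Continuous fun s : ℝ => 2 / Real.pi * Real.sqrt (1 - s ^ 2) :=
    continuous_const.mul (Real.continuous_sqrt.comp (by fun_prop))
  rcases lt_or_ge x (-1) with hlt | hge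
  · -- empty
    have hempty : Iic x ∩ Icc (-1 : ℝ) 1 = ∅ := by
      ext s; simp only [mem_inter_iff, mem_Iic, mem_Icc, mem_empty_iff_false, iff_false, not_and, not_le]; intro h h'; linarith
    rw [hempty, Measure.restrict_empty, lintegral_zero_measure, Real.arccos_of_le_neg_one hlt.le, Real.sqrt_eq_zero'.2 (by nlinarith)]
    simp
  · set y : ℝ := min x 1 with hy
    have hy1 : -1 ≤ y := le_min hge (by norm_num)
    have hy2 : y ≤ 1 := min_le_right _ _
    have hset : Iic x ∩ Icc (-1 : ℝ) 1 = Icc (-1) y := by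
      ext s; simp only [mem_inter_iff, mem_Iic, mem_Icc, hy, le_min_iff]; tauto
    rw [hset, ← ofReal_integral_eq_lintegral_ofReal (hcont.integrableOn_Icc) (Filter.Eventually.of_forall fun s => by positivity),
      integral_Icc_eq_integral_Ioc, ← intervalIntegral.integral_of_le hy1, integral_semicircle_density hy1 hy2]
    -- `F(min x 1) = F(x)` (for `x ≥ 1` both are `1`)
    rcases le_or_gt x 1 with hx1 | hx1
    · rw [hy, min_eq_left hx1]
    · have h1 : Real.sqrt (1 - x ^ 2) = 0 := Real.sqrt_eq_zero'.2 (by nlinarith)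
      rw [hy, min_eq_right hx1.le]
      simp [Real.arccos_one, Real.arccos_of_one_le hx1.le, h1]

/-- ★★★ **THE LAW OF `re(q u)` IS THE SEMICIRCLE LAW**: the push-forward of Haar measure on `SU(2)` under `u ↦ re(q u)` is
`(2/π)√(1−s²)·ds` on `[−1,1]`. [folklore] -/
theorem map_re_eq_semicircle :
    (haarProbability (Matrix.specialUnitaryGroup (Fin 2) ℂ)).map (fun u : Matrix.specialUnitaryGroup (Fin 2) ℂ => (su2Quat u).re) =
      ((volume : Measure ℝ).restrict (Icc (-1) 1)).withDensity (fun s => ENNReal.ofReal (2 / Real.pi * Real.sqrt (1 - s ^ 2))) := by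
  haveI : IsFiniteMeasure ((haarProbability (Matrix.specialUnitaryGroup (Fin 2) ℂ)).map
      (fun u : Matrix.specialUnitaryGroup (Fin 2) ℂ => (su2Quat u).re)) := Measure.isFiniteMeasure_map _ _
  have hmeas : Measurable (fun u : Matrix.specialUnitaryGroup (Fin 2) ℂ => (su2Quat u).re) :=
    (Quaternion.continuous_re.comp continuous_su2Quat).measurable
  refine Measure.ext_of_Iic _ _ fun x => ?_
  rw [Measure.map_apply hmeas measurableSet_Iic, semicircle_Iic,
    show (fun u : Matrix.specialUnitaryGroup (Fin 2) ℂ => (su2Quat u).re) ⁻¹' Iic x = {u | (su2Quat u).re ≤ x} from rfl]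
  have h := haar_re_le_eq x
  rw [measureReal_def] at h
  rw [← h, ENNReal.ofReal_toReal (measure_ne_top _ _)]

/-- ★★★ **SEMICIRCLE TRANSFER FORMULA**: `∫ g(re(q u)) dHaar(u) = ∫_{[−1,1]} g(s)·(2/π)√(1−s²) ds` for measurable `g ≥ 0`. [folklore] -/
theorem lintegral_haar_comp_re (g : ℝ → ℝ≥0∞) (hg : Measurable g) :
    ∫⁻ u, g ((su2Quat u).re) ∂(haarProbability (Matrix.specialUnitaryGroup (Fin 2) ℂ)) =
      ∫⁻ s in Icc (-1 : ℝ) 1, g s * ENNReal.ofReal (2 / Real.pi * Real.sqrt (1 - s ^ 2)) := by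
  have hd : Measurable fun s : ℝ => ENNReal.ofReal (2 / Real.pi * Real.sqrt (1 - s ^ 2)) :=
    ENNReal.measurable_ofReal.comp (continuous_const.mul (Real.continuous_sqrt.comp (by fun_prop))).measurable
  have hmeas : Measurable (fun u : Matrix.specialUnitaryGroup (Fin 2) ℂ => (su2Quat u).re) :=
    (Quaternion.continuous_re.comp continuous_su2Quat).measurable
  rw [← lintegral_map hg hmeas, map_re_eq_semicircle, lintegral_withDensity_eq_lintegral_mul _ hd hg]
  refine lintegral_congr fun s => ?_
  simp only [Pi.mul_apply, mul_comm]

end Summit.QuantumFields.YangMills.Theorems.SwapVirialDeficit.ZeroModeExact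

end
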